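/-
Copyright (c) 2026 the pub-hodgecm-mathlib formalisation cell (harness21).  Prover seat hodgecm-mathlib-F0P2-p06 (g12): road «S3-ram» (LEAD F0P3a-plan (g12); architect
A-p16 (g31) 23:44:48Z ORGAN CALL, skeleton v5 c7e2ff9713160db6 stub B′e :156; owner F0P3a-p06 (g15)), organ B′e «THE H-SIDE PROFILES, EXPLICIT EDITION»; 2026-09-01.
-/
import Literature.NumberTheory.Rogawski1990.DepthZeroTransferHValuesBasisRamified          -- ★ p847008 (this seat): the CORE `stableOrbitalIntegralRel_indicator_vertexTypes_ramified` (literal `Y♮`, generic vertex types `K₂`)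
import Literature.NumberTheory.Rogawski1990.DepthZeroTransferHValuesRamifiedClosedForms     -- ★ p846997 (this seat): `hProfile_zero∕one_closedForm_of_odd` (`Y♮0(2n+1) = 4S − 2`, `Y♮1(2n+1) = 4S`)
import HarnessLib

/-!
# The depth-zero endoscopic transfer for `U(2,1)`, TAME-RAMIFIED place, type (1): THE H-SIDE PROFILES OF `ψ^ram = ![χ⁰, χ♯]` — EXPLICIT EDITION
# (Rogawski 1990 §4.9, §8.1; Labesse–Langlands 1979 §2, §5)

Topic `NumberTheory/Rogawski1990`; namespace `Literature.NumberTheory.Rogawski1990`.  THEOREMS ONLY (no definition, no named fact, no instance, no notation, no `sorry`);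
kernel lane `--supports stmt-HodgeConjecture-24833`.  Cell `pub/hodgecm-mathlib` (D-0151), crux H413; road «S3-ram», P-1-ram skeleton v5 (architect A-p16 (g31)) stub
**B′e `stub_typeOne_HSideExplicit_ram` :156, TOKEN FOR TOKEN**: the ∃-`Y` editions ★ p846978 ∕ ★ p847020 of this seat state the two H-side stable orbital integrals
near `1` as `ν_H(K_H)·Y_s(N)` for SOME profile `Y`; the end-game head `typeOneRow_ram_of_stubs` needs the VALUES.  They are read off the CORE ★ p847008 (whose
conclusion carries the literal EDGE∕VERTEX `q`-sums `Y♮0`, `Y♮1`) and the closed forms ★ p846997 at odd depth `N = 2n + 1`: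
  `Φ^st(γ_H, χ⁰) = ν_H(K_H)·(4·Σ_{k ≤ n} q^k − 2)`,   `Φ^st(γ_H, χ♯) = ν_H(K♯ × U₁)·(4·Σ_{k ≤ n} q^k)`,   `q = Nm(v) = |𝓞_{L⁺}∕v|`
(`χ⁰ = 1_{K_H}·[residually trivial at w]`, replaced on the stable orbit by `1_{K⁰ × U₁}` exactly as in ★ p846978 — every `K_H`-point of the stable orbit of a deep
split-regular `γ_H` is residually unipotent (★ `sq_redMat_sub_one_eq_zero_of_isLocalStablyConjH`) hence residually trivial at a ramified `w` (★ p846905);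
`χ♯ = 1_{K♯ × U₁}` with `K♯ = {g | D_ϖ⁻¹ E₂(g) D_ϖ ∈ GL₂(𝒪_w)}` = the skeleton's entrywise set, ★ `coe_mem_map_conj_glDiagonal_iff_forall_v_le_one`).  The neighbourhood
is the CORE's `V` cut by the residually-unipotent tube (★ `setOf_residuallyUnipotent_endoEmbLocal_mem_nhds_one`); `q` is cast through ★ `Ideal.absNorm_apply` ∕
`Submodule.cardQuot_apply`.  One theorem, binders AND conclusion = the v5 stub text VERBATIM (A-p16 closes :156 by `exact`).

HONEST LABEL: HC_CM is proved only modulo the 2 remaining named inputs (hLiu418 24832, h413 24833) until rung 0 closes; nothing printed is asserted here (assembly of ★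
results); «S3-ram» has no books consequence.

## References
* [Rogawski1990] J. Rogawski, *Automorphic Representations of Unitary Groups in Three Variables*, Ann. of Math. Stud. 123 (1990), §4.9 Lemma 4.9.3 p. 56, Prop. 4.9.1
  p. 55; §8.1 Prop. 8.1.1 p. 112 (the H-side of the depth-zero transfer at a ramified place).
* [LabesseLanglands1979] J.-P. Labesse, R. P. Langlands, *L-indistinguishability for SL(2)*, Canad. J. Math. 31 (1979), §2 Lemma 2.1, §5 (stable orbital integrals of
  the two vertex-stabiliser units on the ramified tree).
-/

set_option autoImplicit false

noncomputable section

open Set Filter Topology MeasureTheory Measure NumberField IsDedekindDomain Finset Matrix Polynomial ValuativeRel Function MulAction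
open scoped Matrix MatrixGroups ValuativeRel WithZero

namespace Literature.NumberTheory.Rogawski1990

open Literature.NumberTheory.Automorphic Literature.NumberTheory.Automorphic.UnitaryGroup Literature.NumberTheory.Automorphic.IntegralReduction
open Literature.NumberTheory.GaloisRepresentations

set_option maxHeartbeats 1600000 in
open scoped Classical in
/-- **STUB B′e `stub_typeOne_HSideExplicit_ram` OF THE P-1-ram SKELETON v5, TOKEN FOR TOKEN — THE H-SIDE PROFILES OF `ψ^ram = ![χ⁰, χ♯]`, EXPLICIT EDITION**: near `1`, on
the type-(1) population with split eigen-data of depth `N = 2n+1`: `Φ^st(γ_H, χ⁰) = ν_H(K_H)·(4·Σ_{k<n+1} q^k − 2)` and `Φ^st(γ_H, χ♯) = ν_H(K♯ × U₁)·(4·Σ_{k<n+1} q^k)`,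
`q = Nm(v)` (★ CORE p847008 + ★ closed forms p846997; `χ⁰ ↦ 1_{K⁰ × U₁}` on the stable orbit as in ★ p846978).
[cite: Rogawski1990, §4.9 Lemma 4.9.3 p. 56; §8.1 Prop. 8.1.1 p. 112] [cite: LabesseLanglands1979, §2 Lemma 2.1, §5] -/
theorem stableOrbitalIntegralRel_typeOne_HSideExplicit_ramified
    (L : Type) [Field L] [NumberField L] [IsCMField L]
    {v : HeightOneSpectrum (𝓞 ↥(maximalRealSubfield L))} (w : PlacesOver L v)
    (hw : IsCMField.complexConj L • w.1 = w.1) (he : v.asIdeal.ramificationIdx' w.1.asIdeal ≠ 1)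
    (h2 : IsUnit (2 : 𝒪[(w.1.adicCompletion L)]))
    (ϖ : (w.1.adicCompletion L)) (hϖ : Valued.v ϖ = WithZero.exp (-1 : ℤ)) (hσϖ : galAdicCompletionMap (L := L) (IsCMField.complexConj L) hw ϖ = -ϖ)
    [MeasurableSpace ((cmDatum L 2 (Matrix.of fun i j : Fin 2 => if i.val + j.val + 1 = 2 then (1 : L) else 0)).Local v × (cmDatum L 1 (Matrix.of fun i j : Fin 1 => if i.val + j.val + 1 = 1 then (1 : L) else 0)).Local v)] [BorelSpace ((cmDatum L 2 (Matrix.of fun i j : Fin 2 => if i.val + j.val + 1 = 2 then (1 : L) else 0)).Local v × (cmDatum L 1 (Matrix.of fun i j : Fin 1 => if i.val + j.val + 1 = 1 then (1 : L) else 0)).Local v)]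
    [∀ a : ((cmDatum L 2 (Matrix.of fun i j : Fin 2 => if i.val + j.val + 1 = 2 then (1 : L) else 0)).Local v × (cmDatum L 1 (Matrix.of fun i j : Fin 1 => if i.val + j.val + 1 = 1 then (1 : L) else 0)).Local v), MeasurableSpace (((cmDatum L 2 (Matrix.of fun i j : Fin 2 => if i.val + j.val + 1 = 2 then (1 : L) else 0)).Local v × (cmDatum L 1 (Matrix.of fun i j : Fin 1 => if i.val + j.val + 1 = 1 then (1 : L) else 0)).Local v) ⧸ Subgroup.centralizer ({a} : Set ((cmDatum L 2 (Matrix.of fun i j : Fin 2 => if i.val + j.val + 1 = 2 then (1 : L) else 0)).Local v × (cmDatum L 1 (Matrix.of fun i j : Fin 1 => if i.val + j.val + 1 = 1 then (1 : L) else 0)).Local v)))]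
    [∀ a : ((cmDatum L 2 (Matrix.of fun i j : Fin 2 => if i.val + j.val + 1 = 2 then (1 : L) else 0)).Local v × (cmDatum L 1 (Matrix.of fun i j : Fin 1 => if i.val + j.val + 1 = 1 then (1 : L) else 0)).Local v), BorelSpace (((cmDatum L 2 (Matrix.of fun i j : Fin 2 => if i.val + j.val + 1 = 2 then (1 : L) else 0)).Local v × (cmDatum L 1 (Matrix.of fun i j : Fin 1 => if i.val + j.val + 1 = 1 then (1 : L) else 0)).Local v) ⧸ Subgroup.centralizer ({a} : Set ((cmDatum L 2 (Matrix.of fun i j : Fin 2 => if i.val + j.val + 1 = 2 then (1 : L) else 0)).Local v × (cmDatum L 1 (Matrix.of fun i j : Fin 1 => if i.val + j.val + 1 = 1 then (1 : L) else 0)).Local v)))]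
    (νH : Measure ((cmDatum L 2 (Matrix.of fun i j : Fin 2 => if i.val + j.val + 1 = 2 then (1 : L) else 0)).Local v × (cmDatum L 1 (Matrix.of fun i j : Fin 1 => if i.val + j.val + 1 = 1 then (1 : L) else 0)).Local v)) [νH.IsHaarMeasure] [νH.IsMulRightInvariant]
    {mH : OrbitalMeasureFamily ((cmDatum L 2 (Matrix.of fun i j : Fin 2 => if i.val + j.val + 1 = 2 then (1 : L) else 0)).Local v × (cmDatum L 1 (Matrix.of fun i j : Fin 1 => if i.val + j.val + 1 = 1 then (1 : L) else 0)).Local v)} (hmH : mH.IsCanonical (IsLocalGRegular L v) νH) :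
    ∃ V ∈ 𝓝 (1 : ((cmDatum L 2 (Matrix.of fun i j : Fin 2 => if i.val + j.val + 1 = 2 then (1 : L) else 0)).Local v × (cmDatum L 1 (Matrix.of fun i j : Fin 1 => if i.val + j.val + 1 = 1 then (1 : L) else 0)).Local v)),
      ∀ γH ∈ V, IsLocalGRegular L v γH →
        (∃ x : (w.1.adicCompletion L), (((γH.1.val : GL (Fin 2) (UnitaryGroup.LocalRing L v)).val.map
          (Pi.evalRingHom (fun w' : PlacesOver L v => w'.1.adicCompletion L) w)).charpoly).IsRoot x) →
        ¬ (∃ (y : ((cmDatum L 2 (Matrix.of fun i j : Fin 2 => if i.val + j.val + 1 = 2 then (1 : L) else 0)).Local v × (cmDatum L 1 (Matrix.of fun i j : Fin 1 => if i.val + j.val + 1 = 1 then (1 : L) else 0)).Local v)) (d' : Fin 2 → (UnitaryGroup.LocalRing L v)ˣ),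
          glDiagonal 2 (UnitaryGroup.LocalRing L v) d' = ((y * γH * y⁻¹).1.val : GL (Fin 2) (UnitaryGroup.LocalRing L v))) →
        ∀ (α γ : (w.1.adicCompletion L)),
          ((((γH.1.val : GL (Fin 2) (UnitaryGroup.LocalRing L v)) : Matrix (Fin 2) (Fin 2) (UnitaryGroup.LocalRing L v)).charpoly).map (Pi.evalRingHom (fun w' : PlacesOver L v => w'.1.adicCompletion L) w)).IsRoot α →
          ((((γH.1.val : GL (Fin 2) (UnitaryGroup.LocalRing L v)) : Matrix (Fin 2) (Fin 2) (UnitaryGroup.LocalRing L v)).charpoly).map (Pi.evalRingHom (fun w' : PlacesOver L v => w'.1.adicCompletion L) w)).IsRoot γ →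
          α ≠ γ → ∀ N : ℕ, Valued.v (α - γ) = WithZero.exp (-(N : ℤ)) →
          ∀ n : ℕ, N = 2 * n + 1 →
          stableOrbitalIntegralRel (IsLocalStablyConjH L v) mH
            ((((cmLocalIntegralLevel L 2 (Matrix.of fun i j : Fin 2 => if i.val + j.val + 1 = 2 then (1 : L) else 0) v).prod (cmLocalIntegralLevel L 1 (Matrix.of fun i j : Fin 1 => if i.val + j.val + 1 = 1 then (1 : L) else 0) v) : Subgroup _) : Set _).indicator
              (fun h => if (redMat (((h.1.val : GL (Fin 2) (UnitaryGroup.LocalRing L v)).val.map (Pi.evalRingHom (fun w' : PlacesOver L v => w'.1.adicCompletion L) w))) - 1) ^ 2 = 0 ∧ (redMat (((h.1.val : GL (Fin 2) (UnitaryGroup.LocalRing L v)).val.map (Pi.evalRingHom (fun w' : PlacesOver L v => w'.1.adicCompletion L) w))) - 1).rank = 0 then (1 : ℂ) else 0)) γH = ((νH.real (((cmLocalIntegralLevel L 2 (Matrix.of fun i j : Fin 2 => if i.val + j.val + 1 = 2 then (1 : L) else 0) v).prod (cmLocalIntegralLevel L 1 (Matrix.of fun i j : Fin 1 => if i.val +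 j.val + 1 = 1 then (1 : L) else 0) v) : Subgroup _) : Set _) : ℝ) : ℂ) * (4 * (∑ k ∈ Finset.range (n + 1), (Ideal.absNorm v.asIdeal : ℂ) ^ k) - 2) ∧
          stableOrbitalIntegralRel (IsLocalStablyConjH L v) mH
            (Set.indicator {h : ((cmDatum L 2 (Matrix.of fun i j : Fin 2 => if i.val + j.val + 1 = 2 then (1 : L) else 0)).Local v × (cmDatum L 1 (Matrix.of fun i j : Fin 1 => if i.val + j.val + 1 = 1 then (1 : L) else 0)).Local v) | ∀ a b : Fin 2, Valued.v (ϖ ^ (b : ℕ) * (ϖ ^ (a : ℕ))⁻¹ * (((localNonsplitEquiv (IsCMField.complexConj L) (Matrix.of fun i j : Fin 2 => if i.val + j.val + 1 = 2 then (1 : L) else 0) (IsCMField.complexConj_ne_one L) w hw h.1 : ↥(unitaryGroupOfForm (galAdicCompletionMap (L := L) (IsCMField.complexConj L) hw) (placeForm (Matrix.of fun i j : Fin 2 => if i.val + j.val + 1 = 2 then (1 : L) else 0) w.1))) : GL (Fin 2) (w.1.adicCompletion L)) : Matrix (Fin 2) (Fin 2) (w.1.adicCompletion L)) a b) ≤ 1}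 (fun _ => (1 : ℂ))) γH = ((νH.real {h : ((cmDatum L 2 (Matrix.of fun i j : Fin 2 => if i.val + j.val + 1 = 2 then (1 : L) else 0)).Local v × (cmDatum L 1 (Matrix.of fun i j : Fin 1 => if i.val + j.val + 1 = 1 then (1 : L) else 0)).Local v) | ∀ a b : Fin 2, Valued.v (ϖ ^ (b : ℕ) * (ϖ ^ (a : ℕ))⁻¹ * (((localNonsplitEquiv (IsCMField.complexConj L) (Matrix.of fun i j : Fin 2 => if i.val + j.val + 1 = 2 then (1 : L) else 0) (IsCMField.complexConj_ne_one L) w hw h.1 : ↥(unitaryGroupOfForm (galAdicCompletionMap (L := L) (IsCMField.complexConj L) hw) (placeForm (Matrix.of fun i j : Fin 2 => if i.val + j.val + 1 = 2 then (1 : L) else 0) w.1))) : GL (Fin 2) (w.1.adicCompletion L)) : Matrix (Fin 2) (Fin 2) (w.1.adicCompletion L)) a b) ≤ 1} : ℝ) : ℂ) * (4 * (∑ k ∈ Finset.range (n + 1), (Ideal.absNorm v.asIdeal : ℂ) ^ k)) := by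
  classical
  have hc1 : IsCMField.complexConj L ≠ 1 := IsCMField.complexConj_ne_one L
  haveI : Algebra.IsQuadraticExtension ↥(maximalRealSubfield L) L := IsCMField.isQuadraticExtension L
  haveI hvs : Subsingleton (PlacesOver L v) := PlacesOver.subsingleton_of_smul_eq (IsCMField.complexConj L) hc1 w hw
  have h2v : Valued.v (2 : w.1.adicCompletion L) = 1 := (isUnit_two_integer_iff_valued_eq_one L w.1).1 h2
  have hϖ0 : ϖ ≠ 0 := by
    intro h0
    rw [h0, map_zero] at hϖ
    exact WithZero.coe_ne_zero hϖ.symm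
  obtain ⟨ϖu, hϖu⟩ : ∃ ϖu : (w.1.adicCompletion L)ˣ, (ϖu : w.1.adicCompletion L) = ϖ := ⟨Units.mk0 ϖ hϖ0, rfl⟩
  have hϖ' : Valued.v (ϖu : w.1.adicCompletion L) = WithZero.exp (-1 : ℤ) := by rw [hϖu]; exact hϖ
  have hσϖ' : (galAdicCompletionMap (L := L) (IsCMField.complexConj L) hw) (ϖu : w.1.adicCompletion L) = -(ϖu : w.1.adicCompletion L) := by
    rw [hϖu]; exact hσϖ
  -- the two vertex types `K₂ 0 = K⁰`, `K₂ 1 = K♯` (★ I-5a-ram) and the CORE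
  obtain ⟨K₂, hK0, hd0, hd1', hK₂o, hK₂c, -⟩ := exists_vertexCover_of_ramified L v w hw he h2v ϖu hϖ' hσϖ'
  obtain ⟨V, hV, hcore⟩ := stableOrbitalIntegralRel_indicator_vertexTypes_ramified L w hw he h2 ϖu hϖ' hσϖ' νH hmH K₂ hd0 hd1' hK₂o hK₂c
  -- `K_H = K⁰ × U₁` as a set
  have hK1 : cmLocalIntegralLevel L 1 (Matrix.of fun i j : Fin 1 => if i.val + j.val + 1 = 1 then (1 : L) else 0) v = ⊤ :=
    cmLocalIntegralLevel_one_eq_top_of_smul_eq L _ w hw (isUnit_placeForm_antidiagOne (E := L) 1 w.1)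
  have hKH : (((cmLocalIntegralLevel L 2 (Matrix.of fun i j : Fin 2 => if i.val + j.val + 1 = 2 then (1 : L) else 0) v).prod (cmLocalIntegralLevel L 1 (Matrix.of fun i j : Fin 1 => if i.val + j.val + 1 = 1 then (1 : L) else 0) v) : Subgroup _) : Set ((cmDatum L 2 (Matrix.of fun i j : Fin 2 => if i.val + j.val + 1 = 2 then (1 : L) else 0)).Local v × (cmDatum L 1 (Matrix.of fun i j : Fin 1 => if i.val + j.val + 1 = 1 then (1 : L) else 0)).Local v)) = (((K₂ 0).prod (⊤ : Subgroup ((cmDatum L 1 (Matrix.of fun i j : Fin 1 => if i.val + j.val + 1 = 1 then (1 : L) else 0)).Local v)) : Subgroup _) : Set ((cmDatum L 2 (Matrix.of fun i j : Fin 2 => if i.val + j.val + 1 = 2 then (1 : L) else 0)).Local v × (cmDatum L 1 (Matrix.of fun i j : Fin 1 => if i.val + j.val + 1 = 1 then (1 : L) else 0)).Local v)) := by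
    rw [hK1, ← hK0]
  -- `q = Nm(v) = |𝓞 ∕ v|`
  have hq : ((Nat.card (𝓞 ↥(maximalRealSubfield L) ⧸ v.asIdeal) : ℕ) : ℂ) = (Ideal.absNorm v.asIdeal : ℂ) := by
    rw [Ideal.absNorm_apply, Submodule.cardQuot_apply]
  refine ⟨V ∩ _, Filter.inter_mem hV (setOf_residuallyUnipotent_endoEmbLocal_mem_nhds_one L v w), ?_⟩
  intro γH hγV hreg hsplit hell α γ hα hγ hαγ N hN n hn
  obtain ⟨hγV1, hγV2⟩ := hγV
  simp only [Set.mem_setOf_eq] at hγV2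
  obtain ⟨h0, h1⟩ := hcore γH hγV1 hreg hsplit hell α γ hα hγ hαγ N hN
  -- DEEPNESS on the tube: the eigenvalues `α, γ` are `≡ 1 (mod 𝔪_w)`
  have hfac := charpoly_map_endoEmbLocal_apply L w (γH := γH)
  have hcm : ((((γH.1.val : GL (Fin 2) (LocalRing L v)).val).map (Pi.evalRingHom (fun w' : PlacesOver L v => w'.1.adicCompletion L) w))).charpoly =
      ((((γH.1.val : GL (Fin 2) (LocalRing L v)) : Matrix (Fin 2) (Fin 2) (LocalRing L v)).charpoly).map
        (Pi.evalRingHom (fun w' : PlacesOver L v => w'.1.adicCompletion L) w)) := Matrix.charpoly_map _ _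
  have hα1 : Valued.v (α - 1) < 1 := by
    refine valuation_sub_one_lt_one_of_isRoot_charpoly_of_residuallyUnipotent _ hγV2 ?_
    rw [hfac, Polynomial.IsRoot, eval_mul, hcm, hα.eq_zero, zero_mul]
  have hγ1 : Valued.v (γ - 1) < 1 := by
    refine valuation_sub_one_lt_one_of_isRoot_charpoly_of_residuallyUnipotent _ hγV2 ?_
    rw [hfac, Polynomial.IsRoot, eval_mul, hcm, hγ.eq_zero, zero_mul]
  -- the closed forms at `N = 2n + 1`
  subst hn
  rw [hProfile_zero_closedForm_of_odd (Nat.card (𝓞 ↥(maximalRealSubfield L) ⧸ v.asIdeal)) n, hq] at h0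
  rw [hProfile_one_closedForm_of_odd (Nat.card (𝓞 ↥(maximalRealSubfield L) ⧸ v.asIdeal)) n, hq] at h1
  refine ⟨?_, ?_⟩
  · -- `χ⁰`: on the stable orbit of `γ_H` every `K_H`-point is residually TRIVIAL (★ p846285 ∘ ★ p846905), so `χ⁰` may be replaced by `1_{K⁰ × U₁}`
    refine (stableOrbitalIntegralRel_congr_fun_of_eqOn mH
      {x : ((cmDatum L 2 (Matrix.of fun i j : Fin 2 => if i.val + j.val + 1 = 2 then (1 : L) else 0)).Local v × (cmDatum L 1 (Matrix.of fun i j : Fin 1 => if i.val + j.val + 1 = 1 then (1 : L) else 0)).Local v) | x ∈ (((cmLocalIntegralLevel L 2 (Matrix.of fun i j : Fin 2 => if i.val + j.val + 1 = 2 then (1 : L) else 0) v).prod (cmLocalIntegralLevel L 1 (Matrix.of fun i j : Fin 1 => if i.val + j.val + 1 = 1 then (1 : L) else 0) v) : Subgroup _) : Set ((cmDatum L 2 (Matrix.of fun i j : Fin 2 => if i.val + j.val + 1 = 2 then (1 : L) else 0)).Local v × (cmDatum L 1 (Matrix.of fun i j : Fin 1 => if i.val + j.val + 1 = 1 then (1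 : L) else 0)).Local v)) → redMat (((x.1.val : GL (Fin 2) (UnitaryGroup.LocalRing L v)).val.map (Pi.evalRingHom (fun w' : PlacesOver L v => w'.1.adicCompletion L) w))) = 1}
      ?_ (g := Set.indicator (((cmLocalIntegralLevel L 2 (Matrix.of fun i j : Fin 2 => if i.val + j.val + 1 = 2 then (1 : L) else 0) v).prod (cmLocalIntegralLevel L 1 (Matrix.of fun i j : Fin 1 => if i.val + j.val + 1 = 1 then (1 : L) else 0) v) : Subgroup _) : Set ((cmDatum L 2 (Matrix.of fun i j : Fin 2 => if i.val + j.val + 1 = 2 then (1 : L) else 0)).Local v × (cmDatum L 1 (Matrix.of fun i j : Fin 1 => if i.val + j.val + 1 = 1 then (1 : L) else 0)).Local v)) (fun _ => (1 : ℂ))) ?_).trans ?_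
    · intro b hb y hyK
      exact redMat_eq_one_of_sq_sub_one_eq_zero_of_ramified L v w hw he h2 _ hyK
        (sq_redMat_sub_one_eq_zero_of_isLocalStablyConjH L v w hw hreg α γ hα hγ hαγ hα1 hγ1 hb y hyK)
    · intro x hx
      by_cases hxK : x ∈ (((cmLocalIntegralLevel L 2 (Matrix.of fun i j : Fin 2 => if i.val + j.val + 1 = 2 then (1 : L) else 0) v).prod (cmLocalIntegralLevel L 1 (Matrix.of fun i j : Fin 1 => if i.val + j.val + 1 = 1 then (1 : L) else 0) v) : Subgroup _) : Set ((cmDatum L 2 (Matrix.of fun i j : Fin 2 => if i.val + j.val + 1 = 2 then (1 : L) else 0)).Local v × (cmDatum L 1 (Matrix.of fun i j : Fin 1 => if i.val + j.val + 1 = 1 then (1 : L) else 0)).Local v))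
      · have hr := hx hxK
        rw [Set.indicator_of_mem hxK, Set.indicator_of_mem hxK, if_pos]
        refine ⟨?_, ?_⟩
        · rw [hr, sub_self, zero_pow two_ne_zero]
        · rw [hr, sub_self, Matrix.rank_zero]
      · rw [Set.indicator_of_notMem hxK, Set.indicator_of_notMem hxK]
    · rw [hKH]
      exact h0
  · -- `χ♯`: the skeleton's set IS `K♯ × U₁` (★ `coe_mem_map_conj_glDiagonal_iff_forall_v_le_one`)
    have hset : {h : ((cmDatum L 2 (Matrix.of fun i j : Fin 2 => if i.val + j.val + 1 = 2 then (1 : L) else 0)).Local v × (cmDatum L 1 (Matrix.of fun i j : Fin 1 => if i.val + j.val + 1 = 1 then (1 : L) else 0)).Local v) | ∀ a b : Fin 2, Valued.v (ϖ ^ (b : ℕ) * (ϖ ^ (a : ℕ))⁻¹ * (((localNonsplitEquiv (IsCMField.complexConj L) (Matrix.of fun i j : Fin 2 => if i.val + j.val + 1 = 2 then (1 : L) else 0) (IsCMField.complexConj_ne_one L) w hw h.1 : ↥(unitaryGroupOfForm (galAdicCompletionMap (L := L) (IsCMField.complexConj L) hw) (placeForm (Matrix.of fun i j : Fin 2 =>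 if i.val + j.val + 1 = 2 then (1 : L) else 0) w.1))) : GL (Fin 2) (w.1.adicCompletion L)) : Matrix (Fin 2) (Fin 2) (w.1.adicCompletion L)) a b) ≤ 1} = (((K₂ 1).prod (⊤ : Subgroup ((cmDatum L 1 (Matrix.of fun i j : Fin 1 => if i.val + j.val + 1 = 1 then (1 : L) else 0)).Local v)) : Subgroup _) : Set ((cmDatum L 2 (Matrix.of fun i j : Fin 2 => if i.val + j.val + 1 = 2 then (1 : L) else 0)).Local v × (cmDatum L 1 (Matrix.of fun i j : Fin 1 => if i.val + j.val + 1 = 1 then (1 : L) else 0)).Local v)) := by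
      ext x
      rw [Set.mem_setOf_eq, SetLike.mem_coe, Subgroup.mem_prod, hd1' x.1,
        coe_mem_map_conj_glDiagonal_iff_forall_v_le_one L w hw ϖu]
      simp only [diagonal_inv_mul_mul_diagonal_apply_eq, hϖu, Subgroup.mem_top, and_true]
    rw [hset]
    exact h1

end Literature.NumberTheory.Rogawski1990

end
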